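import Summits.MatrixMultiplication.OmegaCensus.SmallFormats.MatMul228GF3CoverTables
import Summits.MatrixMultiplication.OmegaCensus.SmallFormats.MatMul229GF3CoverCases
import HarnessLib

/-!
# ω-census family (a): the `(8,27)` cover certificate over `𝔽₃` — specification, WLOG reductions, and the cover theorem

Cell `pub-omega` (unit `pub-omega-tensor`, gen 41), topic `Summits/MatrixMultiplication/OmegaCensus` (sub-folder `SmallFormats`). Framing
(verbatim): lottery ticket; floor = certified bounds/negative ranges. HONEST FRAMING: bookkeeping — the `(8,27)` twin of `MatMul229GF3CoverSpec` /
`…CoverCases`: the loaded-branch clause system `Cover827.Adm827` of `Enum723.funnel_827` (p730384) — J/`𝔽₉` loads `≤ 3`, row/column loads `≤ 4`,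
invertible lines `≤ 9`, digits `≤ 3`, total `27`, `σ ≥ 11`, and tensor g38's LOADED-PLANE clause (p726621: load `≥ 3 ⇒ 16 + load ≤ σ + 8`) — its
invariance under the five generators, WLOG 1 (sorted plane loads), the sub-systems `rowsNa` (`σ ≥ 12`, not all-4), `rowsNb` (`σ = 11`: all plane
loads `≤ 3`), `rowsA8` (all-4; WLOG 2 = translate + conjugate as at `(9,30)`), and `cover827_of_covers`: GIVEN the kernel replays (as
`BoxCover.Covers` hypotheses), every admissible count vector is a group image of the count vector of one of tensor g39's 15 kill-list
representatives `K1–K15` (`rep827cL`). Nothing here is a bound on any rank; nothing on `ω`.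
-/

namespace Summit.MatrixMultiplication.OmegaCensus.SmallFormats.Cover827

open Finset Enum723 BoxCover Cover930

set_option maxRecDepth 4000

/-! ## The clause system of the loaded branch at `(8,27)` -/
/-- Caps at `(8,27)`: J-planes and `𝔽₉`-planes `3`, row/column planes `4`, invertible lines `9`. -/
def cap827 (k : ℕ) : ℕ := if cap k = 4 then 4 else if cap k = 9 then 9 else 3

/-- The caps by block. -/
theorem cap827_eq : ∀ k, k < 82 → cap827 k = if k < 32 then 3 else if k < 40 then 4 else if k < 58 then 3 else 9 := by decide

/-- **Admissible count vectors of the loaded branch at `(8,27)`** (with the loaded-plane clause). -/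
def Adm827 (c : ℕ → ℕ) : Prop :=
  (∀ k, k < 82 → load c k ≤ cap827 k) ∧ (∀ a, a < 40 → c a ≤ 3) ∧ tot c = 27 ∧ 11 ≤ acnt c ∧
    (∀ k, 32 ≤ k → k < 40 → 3 ≤ load c k → 16 + load c k ≤ acnt c + 8)

/-- A generator preserves admissibility. -/
theorem adm827_actS (s : ℕ) (hs : s < 5) {c : ℕ → ℕ} (h : Adm827 c) : Adm827 (actS s c) := by
  obtain ⟨hcap, hdig, htot, hac, hlp⟩ := h
  refine ⟨fun k hk => ?_, fun b hb => hdig _ ((gen_perm s hs).2.2 b hb).1, by rw [tot_actS s hs]; exact htot,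
    by rw [acnt_actS s hs]; exact hac, fun k hk1 hk2 h3 => ?_⟩
  · obtain ⟨hk', hcapk, -⟩ := gen_clause s hs k hk
    rw [load_actS s hs c k hk]
    have : cap827 (kinv s k) = cap827 k := by simp only [cap827, hcapk]
    rw [← this]; exact hcap _ hk'
  · rw [load_actS s hs c k (by omega)] at h3 ⊢
    rw [acnt_actS s hs]
    obtain ⟨h1, h2⟩ := kinv_plane s hs k hk1 hk2
    exact hlp _ h1 h2 h3

/-- Words preserve admissibility. -/
theorem adm827_actWS (w : List ℕ) (hw : WordOK w) {c : ℕ → ℕ} (h : Adm827 c) : Adm827 (actWS w c) := by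
  induction w generalizing c with
  | nil => exact h
  | cons s w ih => exact ih (fun t ht => hw t (by simp [ht])) (adm827_actS s (hw s (by simp)) h)

/-- Plane loads of an admissible vector are `≤ 4`. -/
theorem load_plane_le827 (c : ℕ → ℕ) (h : Adm827 c) (k : ℕ) (hk1 : 32 ≤ k) (hk2 : k < 40) : load c k ≤ 4 := by
  have := h.1 k (by omega)
  rw [cap827_eq k (by omega)] at this
  simp only [show ¬ k < 32 by omega, hk2, if_false, if_true] at this
  exact this

/-! ### WLOG 1: sorting the plane loads (as at `(9,30)`) -/
/-- **WLOG 1 at `(8,27)`**: the plane loads can be sorted by a word. -/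
theorem exists_sorted827 (c : ℕ → ℕ) (h : Adm827 c) : ∃ w, WordOK w ∧ SortedRC (actWS w c) := by
  obtain ⟨i, hi, s1, s2, s3⟩ := exists_sort4_fun (fun t => load c (32 + t))
    (fun t ht => load_plane_le827 c h (32 + t) (by omega) (by omega))
  obtain ⟨hw1, hrow1, hcol1⟩ := wRow_fact i hi
  set w1 := wRowL.getD i [] with hw1def
  set c1 := actWS w1 c with hc1
  have er : ∀ t, t < 4 → load c1 (32 + t) = load c (32 + P4 i t) := fun t ht => by
    rw [hc1, load_actWS w1 hw1 c _ (by omega), hrow1 t ht, P4]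
  have h1 : Adm827 c1 := adm827_actWS w1 hw1 h
  obtain ⟨i', hi', t1, t2, t3⟩ := exists_sort4_fun (fun t => load c1 (36 + t))
    (fun t ht => load_plane_le827 c1 h1 (36 + t) (by omega) (by omega))
  obtain ⟨hw2, hcol2, hrow2⟩ := wCol_fact i' hi'
  set w2 := wColL.getD i' [] with hw2def
  refine ⟨w1 ++ w2, wordOK_append hw1 hw2, ?_⟩
  rw [actWS_append, ← hc1]
  have er' : ∀ t, t < 4 → load (actWS w2 c1) (32 + t) = load c (32 + P4 i t) := fun t ht => by
    rw [load_actWS w2 hw2 c1 _ (by omega), hrow2 t ht, er t ht]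
  have ec' : ∀ t, t < 4 → load (actWS w2 c1) (36 + t) = load c1 (36 + P4 i' t) := fun t ht => by
    rw [load_actWS w2 hw2 c1 _ (by omega), hcol2 t ht, P4]
  refine ⟨?_, ?_, ?_, ?_, ?_, ?_⟩
  · change load (actWS w2 c1) (32 + 1) ≤ load (actWS w2 c1) (32 + 0)
    rw [er' 1 (by norm_num), er' 0 (by norm_num)]; exact s1
  · change load (actWS w2 c1) (32 + 2) ≤ load (actWS w2 c1) (32 + 1)
    rw [er' 2 (by norm_num), er' 1 (by norm_num)]; exact s2
  · change load (actWS w2 c1) (32 + 3) ≤ load (actWS w2 c1) (32 + 2)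
    rw [er' 3 (by norm_num), er' 2 (by norm_num)]; exact s3
  · change load (actWS w2 c1) (36 + 1) ≤ load (actWS w2 c1) (36 + 0)
    rw [ec' 1 (by norm_num), ec' 0 (by norm_num)]; exact t1
  · change load (actWS w2 c1) (36 + 2) ≤ load (actWS w2 c1) (36 + 1)
    rw [ec' 2 (by norm_num), ec' 1 (by norm_num)]; exact t2
  · change load (actWS w2 c1) (36 + 3) ≤ load (actWS w2 c1) (36 + 2)
    rw [ec' 3 (by norm_num), ec' 2 (by norm_num)]; exact t3

/-- In the sorted position: loads `32` and `36` are `≥ 3` (`σ ≥ 11`). -/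
theorem load_32_36_827 (c : ℕ → ℕ) (h : Adm827 c) (hs : SortedRC c) : 3 ≤ load c 32 ∧ 3 ≤ load c 36 := by
  obtain ⟨hr, hc⟩ := plane_sums c
  obtain ⟨s1, s2, s3, t1, t2, t3⟩ := hs
  have := h.2.2.2.1
  have l32 := load_plane_le827 c h 32 (by norm_num) (by norm_num)
  have l36 := load_plane_le827 c h 36 (by norm_num) (by norm_num)
  constructor <;> omega

/-- At `σ = 11` every plane load is `≤ 3` (loaded-plane clause). -/
theorem planes_le_three (c : ℕ → ℕ) (h : Adm827 c) (h11 : acnt c = 11) (k : ℕ) (hk1 : 32 ≤ k) (hk2 : k < 40) :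
    load c k ≤ 3 := by
  by_contra h4
  have := h.2.2.2.2 k hk1 hk2 (by omega)
  have := load_plane_le827 c h k hk1 hk2
  omega

/-- In the sorted position: if load `35` is not `≤ 3` then all eight plane loads are `4`. -/
theorem all4_of_sorted827 (c : ℕ → ℕ) (h : Adm827 c) (hs : SortedRC c) (h35 : ¬ load c 35 ≤ 3) : All4 c := by
  obtain ⟨hr, hc⟩ := plane_sums c
  obtain ⟨s1, s2, s3, t1, t2, t3⟩ := hs
  have l := fun k hk1 hk2 => load_plane_le827 c h k hk1 hk2
  have l32 := l 32 (by norm_num) (by norm_num); have l33 := l 33 (by norm_num) (by norm_num)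
  have l34 := l 34 (by norm_num) (by norm_num); have l35 := l 35 (by norm_num) (by norm_num)
  have l36 := l 36 (by norm_num) (by norm_num); have l37 := l 37 (by norm_num) (by norm_num)
  have l38 := l 38 (by norm_num) (by norm_num); have l39 := l 39 (by norm_num) (by norm_num)
  intro k hk1 hk2
  interval_cases k <;> omega

/-! ## The literal systems mean what they should -/

/-- The indicator row of the rank-one classes (`σ`). -/
def posRk1RowZ : List ℤ := (List.range 40).map fun a => if 24 ≤ a then (1 : ℤ) else 0

/-- The rank-one indicator row evaluates to `σ`. -/
theorem rowVal_posRk1 (c : ℕ → ℕ) : rowVal 40 posRk1RowZ c = (acnt c : ℤ) := by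
  have h := rowVal_rk1 c
  rw [rk1RowZ, rowVal_map] at h
  rw [posRk1RowZ, rowVal_map]
  have : ∑ a ∈ range 40, (if 24 ≤ a then (1 : ℤ) else 0) * (c a : ℤ) = -∑ a ∈ range 40, (if 24 ≤ a then (-1 : ℤ) else 0) * (c a : ℤ) := by
    rw [← Finset.sum_neg_distrib]
    exact Finset.sum_congr rfl fun a _ => by split_ifs <;> ring
  rw [this, h]; ring

/-- The common rows `0–84` at `(8,27)`: clauses (row/column cap `rc`), total `≤ 27`, total `≥ 27`, `σ ≥ smin`. -/
def baseSpec827 (rc : ℕ) (smin : ℤ) (k : ℕ) : List ℤ × ℤ :=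
  if k < 82 then (incRowZ k, if 32 ≤ k ∧ k < 40 then (rc : ℤ) else (cap827 k : ℤ))
  else if k = 82 then (onesRowZ, 27) else if k = 83 then (negOnesRowZ, -27) else (rk1RowZ, -smin)

/-- The rows of `rowsNa`, functionally. -/
def specNa (k : ℕ) : List ℤ × ℤ :=
  if k < 85 then baseSpec827 4 12 k
  else if k = 85 then (diffRowZ 33 32, 0) else if k = 86 then (diffRowZ 34 33, 0) else if k = 87 then (diffRowZ 35 34, 0)
  else if k = 88 then (diffRowZ 37 36, 0) else if k = 89 then (diffRowZ 38 37, 0) else if k = 90 then (diffRowZ 39 38, 0)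
  else if k = 91 then (negIncRowZ 32, -3) else if k = 92 then (negIncRowZ 36, -3) else (incRowZ 35, 3)

/-- The rows of `rowsNb`, functionally. -/
def specNb (k : ℕ) : List ℤ × ℤ :=
  if k < 85 then baseSpec827 3 11 k
  else if k = 85 then (posRk1RowZ, 11)
  else if k = 86 then (diffRowZ 33 32, 0) else if k = 87 then (diffRowZ 34 33, 0) else if k = 88 then (diffRowZ 35 34, 0)
  else if k = 89 then (diffRowZ 37 36, 0) else if k = 90 then (diffRowZ 38 37, 0) else if k = 91 then (diffRowZ 39 38, 0)
  else if k = 92 then (negIncRowZ 32, -3) else (negIncRowZ 36, -3)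

/-- The rows of `rowsA8`, functionally. -/
def specA8 (k : ℕ) : List ℤ × ℤ := if k < 85 then baseSpec827 4 11 k else (negIncRowZ (k - 85 + 32), -4)

/-- The literal tables `rowsNa`, `rowsNb`, `rowsA8` are the functional ones. -/
theorem rows827_eq : (rowsNa.length = 94 ∧ ∀ k, k < 94 → rowsNa.getD k ([], 0) = specNa k) ∧
    (rowsNb.length = 94 ∧ ∀ k, k < 94 → rowsNb.getD k ([], 0) = specNb k) ∧
    (rowsA8.length = 93 ∧ ∀ k, k < 93 → rowsA8.getD k ([], 0) = specA8 k) := by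
  refine ⟨?_, ?_, ?_⟩ <;> decide +kernel

/-- The common rows hold for an admissible vector (with row/column cap `rc ≥` the plane loads and `σ ≥ smin`). -/
theorem baseSpec827_holds (c : ℕ → ℕ) (h : Adm827 c) (rc : ℕ) (smin : ℤ) (hrc : ∀ k, 32 ≤ k → k < 40 → load c k ≤ rc)
    (hs : smin ≤ (acnt c : ℤ)) (k : ℕ) (hk : k < 85) : rowVal 40 (baseSpec827 rc smin k).1 c ≤ (baseSpec827 rc smin k).2 := by
  obtain ⟨hcap, -, htot, hac, -⟩ := h
  by_cases h82 : k < 82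
  · simp only [baseSpec827, if_pos h82, rowVal_inc]
    split_ifs with hp
    · exact_mod_cast hrc k hp.1 hp.2
    · exact_mod_cast hcap k h82
  by_cases e82 : k = 82
  · subst e82; change rowVal 40 onesRowZ c ≤ 27; rw [rowVal_ones]; omega
  by_cases e83 : k = 83
  · subst e83; change rowVal 40 negOnesRowZ c ≤ -27; rw [rowVal_negOnes]; omega
  · have e84 : k = 84 := by omega
    subst e84; change rowVal 40 rk1RowZ c ≤ -smin; rw [rowVal_rk1]; omega

/-- **Case `Na`'s system holds** for an admissible sorted vector with `σ ≥ 12` and load `35 ≤ 3`. -/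
theorem sat_rowsNa (c : ℕ → ℕ) (h : Adm827 c) (hs : SortedRC c) (h12 : 12 ≤ acnt c) (h35 : load c 35 ≤ 3) : Sat 40 rowsNa c := by
  intro k hk
  rw [rows827_eq.1.1] at hk
  rw [rows827_eq.1.2 k hk]
  obtain ⟨l32, l36⟩ := load_32_36_827 c h hs
  obtain ⟨s1, s2, s3, t1, t2, t3⟩ := hs
  by_cases h85 : k < 85
  · simp only [specNa, if_pos h85]
    exact baseSpec827_holds c h 4 12 (fun k hk1 hk2 => load_plane_le827 c h k hk1 hk2) (by exact_mod_cast h12) k h85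
  · interval_cases k
    · change rowVal 40 (diffRowZ 33 32) c ≤ 0; rw [rowVal_diff]; omega
    · change rowVal 40 (diffRowZ 34 33) c ≤ 0; rw [rowVal_diff]; omega
    · change rowVal 40 (diffRowZ 35 34) c ≤ 0; rw [rowVal_diff]; omega
    · change rowVal 40 (diffRowZ 37 36) c ≤ 0; rw [rowVal_diff]; omega
    · change rowVal 40 (diffRowZ 38 37) c ≤ 0; rw [rowVal_diff]; omega
    · change rowVal 40 (diffRowZ 39 38) c ≤ 0; rw [rowVal_diff]; omega
    · change rowVal 40 (negIncRowZ 32) c ≤ -3; rw [rowVal_negInc]; omega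
    · change rowVal 40 (negIncRowZ 36) c ≤ -3; rw [rowVal_negInc]; omega
    · change rowVal 40 (incRowZ 35) c ≤ 3; rw [rowVal_inc]; omega

/-- **Case `Nb`'s system holds** for an admissible sorted vector with `σ = 11`. -/
theorem sat_rowsNb (c : ℕ → ℕ) (h : Adm827 c) (hs : SortedRC c) (h11 : acnt c = 11) : Sat 40 rowsNb c := by
  intro k hk
  rw [rows827_eq.2.1.1] at hk
  rw [rows827_eq.2.1.2 k hk]
  obtain ⟨l32, l36⟩ := load_32_36_827 c h hs
  obtain ⟨s1, s2, s3, t1, t2, t3⟩ := hs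
  by_cases h85 : k < 85
  · simp only [specNb, if_pos h85]
    exact baseSpec827_holds c h 3 11 (fun k hk1 hk2 => planes_le_three c h h11 k hk1 hk2) (by exact_mod_cast h11.ge) k h85
  · interval_cases k
    · change rowVal 40 posRk1RowZ c ≤ 11; rw [rowVal_posRk1]; omega
    · change rowVal 40 (diffRowZ 33 32) c ≤ 0; rw [rowVal_diff]; omega
    · change rowVal 40 (diffRowZ 34 33) c ≤ 0; rw [rowVal_diff]; omega
    · change rowVal 40 (diffRowZ 35 34) c ≤ 0; rw [rowVal_diff]; omega
    · change rowVal 40 (diffRowZ 37 36) c ≤ 0; rw [rowVal_diff]; omega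
    · change rowVal 40 (diffRowZ 38 37) c ≤ 0; rw [rowVal_diff]; omega
    · change rowVal 40 (diffRowZ 39 38) c ≤ 0; rw [rowVal_diff]; omega
    · change rowVal 40 (negIncRowZ 32) c ≤ -3; rw [rowVal_negInc]; omega
    · change rowVal 40 (negIncRowZ 36) c ≤ -3; rw [rowVal_negInc]; omega

/-- **The all-4 system holds** for an admissible all-4 vector. -/
theorem sat_rowsA8 (c : ℕ → ℕ) (h : Adm827 c) (h4 : All4 c) : Sat 40 rowsA8 c := by
  intro k hk
  rw [rows827_eq.2.2.1] at hk
  rw [rows827_eq.2.2.2 k hk]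
  by_cases h85 : k < 85
  · simp only [specA8, if_pos h85]
    exact baseSpec827_holds c h 4 11 (fun k hk1 hk2 => load_plane_le827 c h k hk1 hk2) (by exact_mod_cast h.2.2.2.1) k h85
  · simp only [specA8, if_neg h85, rowVal_negInc]
    have := h4 (k - 85 + 32) (by omega) (by omega)
    omega

/-! ## From listed solutions to words -/

/-- Representative `j` (`K(j+1)` of tensor g39's kill list) as a count vector. -/
def repv827 (j : ℕ) : ℕ → ℕ := fun b => (rep827cL.getD j []).getD b 0

/-- The representative count vectors have 40 digits. -/
theorem rep827cL_length : ∀ j, j < 15 → (rep827cL.getD j []).length = 40 := by decide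

/-- **A solution listed with certificates is a group image of a representative.** -/
theorem word_of_certs {certs : List (List ℕ × ℕ × List ℕ)}
    (hcerts : ∀ e ∈ certs, e.2.1 < 15 ∧ WordOK e.2.2 ∧ actW e.2.2 (rep827cL.getD e.2.1 []) = e.1) {c : ℕ → ℕ}
    (hl : Listed 40 (certs.map fun e => e.1) c) : ∃ j, j < 15 ∧ ∃ w, WordOK w ∧ Eq40 c (actWS w (repv827 j)) := by
  obtain ⟨v, hv, hcv⟩ := hl
  rw [List.mem_map] at hv
  obtain ⟨e, he, rfl⟩ := hv
  obtain ⟨hj, hw, hact⟩ := hcerts e he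
  refine ⟨e.2.1, hj, e.2.2, hw, fun b hb => ?_⟩
  rw [hcv b hb, ← hact]
  exact actW_getD e.2.2 hw _ (rep827cL_length _ hj) b hb

/-- Transport of a word certificate back along a WLOG word. -/
theorem uncertify827 {c : ℕ → ℕ} {v : List ℕ} (hv : WordOK v) {j : ℕ} {w : List ℕ} (hw : WordOK w)
    (h : Eq40 (actWS v c) (actWS w (repv827 j))) : ∃ w', WordOK w' ∧ Eq40 c (actWS w' (repv827 j)) := by
  refine ⟨w ++ invW v, wordOK_append hw (wordOK_invW hv), fun b hb => ?_⟩
  rw [actWS_append, ← actWS_invW v hv c b hb]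
  exact actWS_congr _ (wordOK_invW hv) h b hb

/-! ## WLOG 2 and the cover theorem -/

/-- In the all-4 position an invertible class is present. -/
theorem exists_inv_pos827 {c : ℕ → ℕ} (h : Adm827 c) (h4 : All4 c) : ∃ a₀, a₀ < 24 ∧ 1 ≤ c a₀ := by
  by_contra hne
  push Not at hne
  have hb : bcnt c = 0 := Finset.sum_eq_zero fun a ha => by
    have := hne a (Finset.mem_range.mp ha); omega
  have ht := tot_eq c
  have hr := (plane_sums c).1
  have := h4 32 (by norm_num) (by norm_num); have := h4 33 (by norm_num) (by norm_num); have := h.2.2.1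
  have := h4 34 (by norm_num) (by norm_num); have := h4 35 (by norm_num) (by norm_num); omega

/-- **The cover theorem at `(8,27)`, given the kernel replays**: every admissible count vector of the loaded branch is a group image —
by a word in the five generators — of the count vector of one of the 15 representatives (`repv827 j`, `j < 15`). The solution lists enter
with their certificates `certsNa`, `certsK`. -/
theorem cover827_of_covers {certsNa certsK : List (List ℕ × ℕ × List ℕ)}
    (hcNa : ∀ e ∈ certsNa, e.2.1 < 15 ∧ WordOK e.2.2 ∧ actW e.2.2 (rep827cL.getD e.2.1 []) = e.1)
    (hcK : ∀ e ∈ certsK, e.2.1 < 15 ∧ WordOK e.2.2 ∧ actW e.2.2 (rep827cL.getD e.2.1 []) = e.1)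
    (hNa : Covers rowsNa (certsNa.map fun e => e.1) 40 lo0 hi3) (hNb : Covers rowsNb [] 40 lo0 hi3)
    (hK : Covers rowsA8 (certsK.map fun e => e.1) 40 loK hi3) (hG : Covers rowsA8 [] 40 loG hiG)
    (hT : Covers rowsA8 [] 40 loT hiT) (hD : Covers rowsA8 [] 40 lo0 hiD) (c : ℕ → ℕ) (h : Adm827 c) :
    ∃ j, j < 15 ∧ ∃ w, WordOK w ∧ Eq40 c (actWS w (repv827 j)) := by
  -- WLOG 1: sorted plane loads
  obtain ⟨v₁, hv₁, hs⟩ := exists_sorted827 c h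
  set c₁ := actWS v₁ c with hc₁
  have h₁ : Adm827 c₁ := adm827_actWS v₁ hv₁ h
  suffices H : ∃ j, j < 15 ∧ ∃ w, WordOK w ∧ Eq40 c₁ (actWS w (repv827 j)) by
    obtain ⟨j, hj, w, hw, he⟩ := H; exact ⟨j, hj, uncertify827 hv₁ hw he⟩
  have hbox : InBox 40 lo0 hi3 c₁ := fun b hb => by
    obtain ⟨e0, e3, -⟩ := boxes_eq b hb
    rw [e0, e3]; exact ⟨Nat.zero_le _, h₁.2.1 b hb⟩
  by_cases h11 : acnt c₁ = 11
  · -- case Nb: empty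
    exfalso
    exact not_listed_nil (hNb c₁ hbox (sat_rowsNb c₁ h₁ hs h11))
  have h12 : 12 ≤ acnt c₁ := by have := h₁.2.2.2.1; omega
  by_cases h35 : load c₁ 35 ≤ 3
  · -- case Na: listed
    exact word_of_certs hcNa (hNa c₁ hbox (sat_rowsNa c₁ h₁ hs h12 h35))
  have h4 : All4 c₁ := all4_of_sorted827 c₁ h₁ hs h35
  -- WLOG 2a: translate a present invertible class to class 0
  obtain ⟨a₀, ha₀, ha1⟩ := exists_inv_pos827 h₁ h4
  obtain ⟨hsrc, hv₂⟩ := wTrans_fact a₀ ha₀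
  set v₂ := wTransL.getD a₀ [] with hv₂def
  set c₂ := actWS v₂ c₁ with hc₂
  have h₂ : Adm827 c₂ := adm827_actWS v₂ hv₂ h₁
  have h4₂ : All4 c₂ := all4_actWS v₂ hv₂ h4
  have h0 : 1 ≤ c₂ 0 := by rw [hc₂, actWS_apply, hsrc]; exact ha1
  suffices H : ∃ j, j < 15 ∧ ∃ w, WordOK w ∧ Eq40 c₂ (actWS w (repv827 j)) by
    obtain ⟨j, hj, w, hw, he⟩ := H; exact ⟨j, hj, uncertify827 hv₂ hw he⟩
  have mk : ∀ (u : List ℕ), WordOK u → ∀ (LO HI : List ℕ),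
      (∀ b, b < 40 → LO.getD b 0 ≤ actWS u c₂ b ∧ actWS u c₂ b ≤ HI.getD b 0) →
      InBox 40 LO HI (actWS u c₂) ∧ Sat 40 rowsA8 (actWS u c₂) := fun u hu LO HI hB =>
    ⟨hB, sat_rowsA8 _ (adm827_actWS u hu h₂) (all4_actWS u hu h4₂)⟩
  by_cases hk4 : ∃ a, a ∈ cyc4L ∧ 1 ≤ c₂ a
  · -- case κ
    obtain ⟨a, ha, ha1'⟩ := hk4
    obtain ⟨hs0, hs1, hu⟩ := wKap_fact a ha
    set u := wKapC.getD a [] with hudef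
    obtain ⟨hB, hS⟩ := mk u hu loK hi3 fun b hb => by
      obtain ⟨-, e3, eK, -⟩ := boxes_eq b hb
      rw [e3, eK, actWS_apply]
      refine ⟨?_, (adm827_actWS u hu h₂).2.1 b hb |>.trans_eq' (by rw [actWS_apply])⟩
      split_ifs with h01
      · rcases h01 with rfl | rfl
        · rw [hs0]; exact h0
        · rw [hs1]; exact ha1'
      · exact Nat.zero_le _
    obtain ⟨j, hj, w, hw, he⟩ := word_of_certs hcK (hK _ hB hS)
    exact ⟨j, hj, uncertify827 hu hw he⟩
  push Not at hk4
  by_cases hk3 : ∃ a, a ∈ cyc3L ∧ 1 ≤ c₂ a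
  · -- case γ: empty
    exfalso
    obtain ⟨a, ha, ha1'⟩ := hk3
    obtain ⟨hs0, hs5, hu, h4c⟩ := wGam_fact a ha
    set u := wGamC.getD a [] with hudef
    obtain ⟨hB, hS⟩ := mk u hu loG hiG fun b hb => by
      obtain ⟨-, -, -, eG, eG', -⟩ := boxes_eq b hb
      rw [eG, eG', actWS_apply]
      have hsb := srcW_lt _ hu b hb
      refine ⟨?_, ?_⟩
      · split_ifs with h05
        · rcases h05 with rfl | rfl
          · rw [hs0]; exact h0
          · rw [hs5]; exact ha1'
        · exact Nat.zero_le _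
      · split_ifs with hc4
        · have := hk4 _ (h4c b hc4); omega
        · exact h₂.2.1 _ hsb
    exact not_listed_nil (hG _ hB hS)
  push Not at hk3
  by_cases hk2 : ∃ a, a ∈ transL ∧ 1 ≤ c₂ a
  · -- case τ: empty
    exfalso
    obtain ⟨a, ha, ha1'⟩ := hk2
    obtain ⟨hs0, hs4, hu, h4c, h3c⟩ := wTau_fact a ha
    set u := wTauC.getD a [] with hudef
    obtain ⟨hB, hS⟩ := mk u hu loT hiT fun b hb => by
      obtain ⟨-, -, -, -, -, eT, eT', -⟩ := boxes_eq b hb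
      rw [eT, eT', actWS_apply]
      have hsb := srcW_lt _ hu b hb
      refine ⟨?_, ?_⟩
      · split_ifs with h04
        · rcases h04 with rfl | rfl
          · rw [hs0]; exact h0
          · rw [hs4]; exact ha1'
        · exact Nat.zero_le _
      · split_ifs with hc
        · rcases hc with hc | hc
          · have := hk4 _ (h4c b hc); omega
          · have := hk3 _ (h3c b hc); omega
        · exact h₂.2.1 _ hsb
    exact not_listed_nil (hT _ hB hS)
  push Not at hk2
  -- case δ: empty
  exfalso
  obtain ⟨hB, hS⟩ := mk [] (fun _ h => by simp at h) lo0 hiD fun b hb => by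
    obtain ⟨e0, -, -, -, -, -, -, eD⟩ := boxes_eq b hb
    rw [e0, eD]
    refine ⟨Nat.zero_le _, ?_⟩
    show c₂ b ≤ _
    split_ifs with hc
    · rcases hc with hc | hc | hc
      · have := hk4 _ hc; omega
      · have := hk3 _ hc; omega
      · have := hk2 _ hc; omega
    · exact h₂.2.1 _ hb
  exact not_listed_nil (hD _ hB hS)

end Summit.MatrixMultiplication.OmegaCensus.SmallFormats.Cover827
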